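import Mathlib
import HarnessLib
import Summits.ResolutionOfSingularities.ResolutionOfSingularities.Theorems.WildQuotientsWildQuotientResolutionZ9PeeledTwistedFinite
import Summits.ResolutionOfSingularities.ResolutionOfSingularities.Theorems.WildQuotientsWildQuotientResolutionZ9PeeledTwistedGraded

/-!
# ℤ9 SPECIMEN (peeled `𝔸⁴/ℤ9`, char 3), brick Z4T: the ALGEBRA-SIDE PACKAGE of the twisted `μ₄` piece `P_T`
(crux stmt-ResolutionOfSingularities-15640 `WildQuotients.WildQuotientResolution`, line `Sketch`; S1 =
stmt-ResolutionOfSingularities-17941; chain w45c card-P specimen «peeled 𝔸⁴/ℤ9», V-BR, brick Z4T; the `(A, S, 𝒮)`,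
`Algebra.FiniteType k S`, `IsRegularRing S` conjuncts of the per-piece chart datum `hchart` of stub-1's Z6 frame
`PeelingFrame.hasResolution_glued_liftAction_of_pieceGradedCharts`, for `A = ZMod 4`, `S = L^{σ̃}`.)
[OURS · L1 W4.5c] — NOT a statement of any manuscript; AI-produced, kernel-checked ≠ expert-reviewed. Def-free.

**`exists_twistedLift_package`**: for the peeled `σ̄` (char 3, `σ̄³ = 1`) there are a lift `σ̃ : L ≃ₐ[k] L` of order 3
with the twisted-lift laws (`exists_twistedLift`) and a `ZMod 4`-grading `𝒮` of `S = L^{σ̃}` by invariant homogeneous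
fractions (`exists_gradedAlgebra_twistedLift_fixedPoints`) with `S` of finite type (`twistedLift_fixedPoints_finiteType`)
and regular (`twistedLift_fixedPoints_isRegularRing`). The seam `𝒮 0 ≃ Γ(P_T)^{σ̄}` is separate (part 3b-iii).
-/

-- single-problem summit: the doubled namespace component `ResolutionOfSingularities` is forced
set_option linter.dupNamespace false

noncomputable section

open MvPolynomial

namespace Summit.ResolutionOfSingularities.ResolutionOfSingularities.Theorems.WildQuotientResolution.Z9Peeled

variable (k : Type) [Field k] (n : ℕ) (a b c d : Fin n)

/-- The `μ₄`-weight `w₄ = (α ↦ 1, S ↦ 1, γ ↦ 3, else 0)` (local shorthand). -/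
local notation3 "wT" => (fun i : Fin n => if i = a then (1 : ZMod 4) else if i = b then 1 else if i = c then 3
  else 0)
/-- `u = 1 − S⁶α²` (local shorthand). -/
local notation3 "uT" => (1 - X b ^ 6 * X a ^ 2 : MvPolynomial (Fin n) k)
/-- `v = 1 + S³α` (local shorthand). -/
local notation3 "vT" => (1 + X b ^ 3 * X a : MvPolynomial (Fin n) k)
/-- `v' = 1 − S³α` (local shorthand). -/
local notation3 "vT'" => (1 - X b ^ 3 * X a : MvPolynomial (Fin n) k)
/-- The twisted root chart ring `L = k[x][u⁻¹]` (local shorthand). -/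
local notation3 "LT" => Localization.Away (1 - X b ^ 6 * X a ^ 2 : MvPolynomial (Fin n) k)
/-- `ι : k[x] → L` (local shorthand). -/
local notation3 "ιT" => algebraMap (MvPolynomial (Fin n) k)
  (Localization.Away (1 - X b ^ 6 * X a ^ 2 : MvPolynomial (Fin n) k))
/-- `J = u⁻¹ ∈ L` (local shorthand). -/
local notation3 "JT" => (IsLocalization.Away.invSelf (1 - X b ^ 6 * X a ^ 2 : MvPolynomial (Fin n) k) :
  Localization.Away (1 - X b ^ 6 * X a ^ 2 : MvPolynomial (Fin n) k))
/-- `iv = ι v'·J` (local shorthand). -/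
local notation3 "ivT" => (algebraMap (MvPolynomial (Fin n) k)
  (Localization.Away (1 - X b ^ 6 * X a ^ 2 : MvPolynomial (Fin n) k)) (1 - X b ^ 3 * X a) *
    (IsLocalization.Away.invSelf (1 - X b ^ 6 * X a ^ 2 : MvPolynomial (Fin n) k) :
      Localization.Away (1 - X b ^ 6 * X a ^ 2 : MvPolynomial (Fin n) k)))

-- six packaged results over the long law binders; head-room
set_option maxHeartbeats 3200000 in
/-- **The algebra-side package of the twisted piece `P_T`.** [OURS · L1 W4.5c] -/
theorem exists_twistedLift_package [CharP k 3] (σ : MvPolynomial (Fin n) k ≃ₐ[k] MvPolynomial (Fin n) k)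
    (hb : σ (X b) = X b + X a) (hc : σ (X c) = X c + X b)
    (hd : σ (X d) = X d + X c ^ 3 - X a ^ 2 * X c)
    (hσ : ∀ i, i ≠ b → i ≠ c → i ≠ d → σ (X i) = X i) (hσ3 : σ ^ 3 = 1)
    (hab : a ≠ b) (hac : a ≠ c) (had : a ≠ d) (hbc : b ≠ c) (hbd : b ≠ d) (hcd : c ≠ d) :
    ∃ σt : LT ≃ₐ[k] LT,
      (σt (ιT (X b)) = ιT (X b * vT) ∧ σt (ιT (X a)) = ιT (X a) * ivT ^ 4 ∧
        σt (ιT (X c)) = ιT (X c) * ivT + ιT (X b ^ 3 * vT') ∧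
        σt (ιT (X d)) = ιT (X d + X b ^ 3 * X c ^ 3 - X b ^ 15 * X a ^ 2 * uT ^ 2 * X c) ∧
        (∀ i, i ≠ a → i ≠ b → i ≠ c → i ≠ d → σt (ιT (X i)) = ιT (X i)) ∧ σt ^ 3 = 1) ∧
      (∀ F, σt (ιT (aeval (fun i : Fin n => if i = a then X b ^ 7 * X a * (1 - X b ^ 6 * X a ^ 2)
          else if i = b then X b ^ 4 * (1 - X b ^ 6 * X a ^ 2) else if i = c then X b * X c
          else (X i : MvPolynomial (Fin n) k)) F)) =
        ιT (aeval (fun i : Fin n => if i = a then X b ^ 7 * X a * (1 - X b ^ 6 * X a ^ 2)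
          else if i = b then X b ^ 4 * (1 - X b ^ 6 * X a ^ 2) else if i = c then X b * X c
          else (X i : MvPolynomial (Fin n) k)) (σ F))) ∧
      Finite ↥(Subgroup.zpowers σt) ∧
      Algebra.FiniteType k (FixedPoints.subalgebra k LT (Subgroup.zpowers σt)) ∧
      IsRegularRing (FixedPoints.subalgebra k LT (Subgroup.zpowers σt)) ∧
      ∃ (𝒮 : ZMod 4 → Submodule k (FixedPoints.subalgebra k LT (Subgroup.zpowers σt)))
        (_ : GradedAlgebra 𝒮),
        ∀ (i : ZMod 4) (s : FixedPoints.subalgebra k LT (Subgroup.zpowers σt)), s ∈ 𝒮 i ↔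
          ∃ (m : ℕ) (f : MvPolynomial (Fin n) k), IsWeightedHomogeneous wT f i ∧
            (s : LT) = ιT f * JT ^ m := by
  obtain ⟨σt, hS, hA, hG, hW, hfix, h3⟩ :=
    exists_twistedLift k n a b c d σ hb hc hd hσ hσ3 hab hac had hbc hbd hcd
  refine ⟨σt, ⟨hS, hA, hG, hW, hfix, h3⟩, ?_, finite_zpowers_twistedLift k n a b σt hS h3,
    twistedLift_fixedPoints_finiteType k n a b σt hS h3,
    twistedLift_fixedPoints_isRegularRing k n a b c d σt hS hA hG hW hfix h3,
    exists_gradedAlgebra_twistedLift_fixedPoints k n a b c d σt hS hA hG hW hfix hac had hbc hbd hcd⟩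
  intro F
  exact lift_comp_twist k n a b c d σ hb hc hd hσ hab hac had hbc hbd hcd (σt : LT →ₐ[k] LT) hS hA hG hW
    hfix F

end Summit.ResolutionOfSingularities.ResolutionOfSingularities.Theorems.WildQuotientResolution.Z9Peeled

end
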